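import Literature.AlgebraicGeometry.CossartPiltant200819.GoodResolution2019
import Literature.AlgebraicGeometry.Crystalline.BlochEsnaultKerzLifting
import Literature.AlgebraicGeometry.Modules.IdealSheafNoetherian
import Mathlib.AlgebraicGeometry.Morphisms.Flat
import HarnessLib

/-!
# Cossart–Piltant 2019: the projectivity clauses (Thm. 1.1 complement, Cor. 1.2, Cor. 1.3)

V. Cossart, O. Piltant, *Resolution of singularities of arithmetical threefolds*, J. Algebra 529
(2019) 268–535 = arXiv:1412.0868, p. 3 of arXiv v1 (held text `paper:arxiv-1412.0868`, chunk 3;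
statements identical in the journal version). `GoodResolution2019.lean` types Thm. 1.1 (i)–(iii)
(`CossartPiltant2019Thm11`, conclusion `HasGoodResolution`) and Cor. 1.2 without the word
"projective" (`CossartPiltant2019Cor12Good`). This file adds the three PROJECTIVITY clauses of
p. 3, which need projective space over a RING base — the tree's
`Crystalline.projectiveSpaceOver n O = Proj O[x₀,…,xₙ]` / `Crystalline.IsProjectiveOverRing`
("admits a closed `O`-immersion into some `ℙⁿ_O`", Hartshorne II.4; it is
`Motives.IsProjectiveOver` verbatim with a ring base, `Crystalline.isProjectiveOverRing_iff`),
hence the import of `Crystalline.BlochEsnaultKerzLifting` (the only tree module defining it;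
nothing crystalline is used):

* `CossartPiltant2019Thm11Projective` — NAMED FACT, Thm. 1.1 INCLUDING its last sentence: "If
  furthermore a finite affine covering `𝒳 = 𝒰₁ ∪ 𝒰₂ ∪ ⋯ ∪ 𝒰ₙ` is specified, one may take
  `π⁻¹(𝒰ᵢ) → 𝒰ᵢ` projective, `1 ≤ i ≤ n`." A specified finite affine covering is a Mathlib
  `Scheme.AffineOpenCover` (open immersions `𝒰.f j : Spec (𝒰.X j) → 𝒳` covering `𝒳`) with
  `Finite 𝒰.I₀`; `π⁻¹(𝒰ⱼ) → 𝒰ⱼ` is the base change `pullback.snd π (𝒰.f j) : 𝒳' ×_𝒳 Spec (𝒰.X j)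
  → Spec (𝒰.X j)`, and "projective" = `IsProjectiveOverRing` over the ring `𝒰.X j`.
* `CossartPiltant2019Cor12` — NAMED FACT, Cor. 1.2 VERBATIM ("`Spec A` has a good resolution of
  singularities which is projective": a good resolution `π : 𝒳' → Spec A` with `𝒳'` projective
  over `A` via `π`).
* `CossartPiltant2019Cor13` — NAMED FACT, Cor. 1.3 (regular proper flat `𝒪`-models of regular
  projective surfaces over the fraction field of an excellent Dedekind domain `𝒪`).
* PROVED bookkeeping: `CossartPiltant2019Thm11Projective.thm11` (forget projectivity: a
  Noetherian scheme HAS a finite affine open cover, `exists_affineOpenCover_finite`);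
  `CossartPiltant2019Cor12.cor12Good`; and `cor12_of_thm11Projective : Thm11Projective →
  Stacks07QU → Stacks07QW_complete → Cor12` — Cor. 1.2 exactly as derived in print (complete
  Noetherian local rings are excellent; apply Thm. 1.1 to the one-piece affine covering
  `Spec A = Spec A`, `affineOpenCoverSelf`; `𝒳' ×_{Spec A} Spec A ≅ 𝒳'` over `A`,
  `isProjectiveOverRing_of_iso`).

Faithfulness / what is not here. Cor. 1.3 is rendered for INTEGRAL `Σ` ("surface" read as an
integral two-dimensional `F`-scheme; the sentence before the corollary speaks of "regular integral
models of projective surfaces"); if print allows reducible `Σ` this rendering is a special case,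
never more. "generic fiber `𝒳_F = Σ`" = an isomorphism of `F`-schemes
`𝒳 ×_{Spec 𝒪} Spec F ≅ Σ`. Cor. 1.3 is NOT derived here from Thm. 1.1 (print: flat projective
closure in `ℙⁿ_𝒪`, excellence of finite-type `𝒪`-schemes, Thm. 1.1, flatness over a Dedekind base
of a regular birational modification — mathematics, not bookkeeping). No proof content of the
paper is vendored.
-/

noncomputable section

open CategoryTheory CategoryTheory.Limits AlgebraicGeometry TopologicalSpace IsLocalRing

namespace Literature.AlgebraicGeometry.CossartPiltant200819.CP2019

open Literature.AlgebraicGeometry.Resolution Literature.AlgebraicGeometry.Motives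
  Literature.AlgebraicGeometry.Crystalline

universe u

/-! ## Plumbing: projectivity along isomorphisms, finite affine covers -/

/-- Projectivity over a ring is invariant under isomorphisms of `O`-schemes: a closed immersion
into `ℙⁿ_O` precomposed with an isomorphism is a closed immersion. [folklore] -/
theorem isProjectiveOverRing_of_iso {O : Type u} [CommRing O] {X Y : SchemeOver O} (e : X ≅ Y)
    (h : IsProjectiveOverRing Y) : IsProjectiveOverRing X := by
  obtain ⟨n, ι, hι⟩ := h
  refine ⟨n, e.hom ≫ ι, ?_⟩
  rw [Over.comp_left]
  infer_instance

/-- A quasi-compact scheme has a FINITE affine open cover: the spectra of the section rings of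
finitely many affine opens covering it (`Modules.exists_finite_affineOpens_iSup_eq_top`,
Mathlib `Scheme.AffineOpenCover.ofIsOpenCover`). [folklore] -/
theorem exists_affineOpenCover_finite (X : Scheme.{u}) [CompactSpace X] :
    ∃ 𝒰 : Scheme.AffineOpenCover.{u} X, Finite 𝒰.I₀ := by
  obtain ⟨t, ht⟩ := Modules.exists_finite_affineOpens_iSup_eq_top (X := X)
  exact ⟨Scheme.AffineOpenCover.ofIsOpenCover (fun V : t => ((V : X.affineOpens) : X.Opens))
    (.mk ht) (fun V => (V : X.affineOpens).2), inferInstanceAs (Finite t)⟩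

/-- The one-piece affine open cover of `Spec A` by the identity `Spec A = Spec A`. [folklore] -/
def affineOpenCoverSelf (A : Type u) [CommRing A] :
    Scheme.AffineOpenCover.{u} (Spec (.of A)) where
  I₀ := PUnit
  X _ := .of A
  f _ := 𝟙 _
  idx _ := PUnit.unit
  covers x := ⟨x, by simp⟩

/-- The one-piece cover is finite. [folklore] -/
instance (A : Type u) [CommRing A] : Finite (affineOpenCoverSelf A).I₀ :=
  inferInstanceAs (Finite PUnit)

/-! ## Theorem 1.1 with projectivity over a specified finite affine covering -/

/-- NAMED FACT — **Cossart–Piltant 2019, Theorem 1.1, complete statement** (conclusions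
(i)–(iii) AND the projectivity complement), VERBATIM: "Let `𝒳` be a reduced and separated
Noetherian scheme which is quasi-excellent and of dimension at most three. There exists a proper
birational morphism `π : 𝒳' → 𝒳` with the following properties: (i) `𝒳'` is everywhere regular;
(ii) `π` induces an isomorphism `π⁻¹(Reg 𝒳) ≃ Reg 𝒳`; (iii) `π⁻¹(Sing 𝒳)` is a strict normal
crossings divisor on `𝒳'`. If furthermore a finite affine covering `𝒳 = 𝒰₁ ∪ 𝒰₂ ∪ ⋯ ∪ 𝒰ₙ` is
specified, one may take `π⁻¹(𝒰ᵢ) → 𝒰ᵢ` projective, `1 ≤ i ≤ n`." Rendering: hypotheses as in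
`CossartPiltant2019Thm11`; the covering is a finite Mathlib `Scheme.AffineOpenCover 𝒰` (open
immersions `𝒰.f j : Spec (𝒰.X j) → 𝒳`, jointly surjective, `Finite 𝒰.I₀`); the conclusion is a
good resolution `π` (`IsGoodResolution`: (i)–(iii) + proper birational) such that every base
change `π⁻¹(𝒰ⱼ) = 𝒳' ×_𝒳 Spec (𝒰.X j) → Spec (𝒰.X j)` is projective over the ring `𝒰.X j`
(`Crystalline.IsProjectiveOverRing`: a closed immersion into some `ℙᴺ` over `𝒰.X j`). This is a
theorem in print. Users take `(h : CossartPiltant2019Thm11Projective)`.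
[cite: CossartPiltant2019, Thm. 1.1 (with the projectivity complement)] -/
def CossartPiltant2019Thm11Projective : Prop :=
  ∀ (X : Scheme.{u}) [X.IsSeparated] [IsNoetherian X] [IsReduced X],
    Scheme.IsQuasiExcellent X → topologicalKrullDim X ≤ 3 →
    ∀ (𝒰 : Scheme.AffineOpenCover.{u} X) [Finite 𝒰.I₀],
      ∃ (X' : Scheme.{u}) (π : X' ⟶ X), IsGoodResolution π ∧
        ∀ j : 𝒰.I₀, IsProjectiveOverRing
          (Over.mk (pullback.snd π (𝒰.f j)) : SchemeOver (𝒰.X j))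

namespace CossartPiltant2019Thm11Projective

/-- Forgetting projectivity: the complete Thm. 1.1 gives `CossartPiltant2019Thm11` (apply it to
any finite affine open cover of the Noetherian scheme `𝒳`, `exists_affineOpenCover_finite`).
[cite: CossartPiltant2019, Thm. 1.1] -/
theorem thm11 (h : CossartPiltant2019Thm11Projective.{u}) : CossartPiltant2019Thm11.{u} := by
  intro X _ _ _ hqe hdim
  obtain ⟨𝒰, h𝒰⟩ := exists_affineOpenCover_finite X
  obtain ⟨X', π, hπ, -⟩ := h X hqe hdim 𝒰
  exact ⟨X', π, hπ⟩

/-- Hence also the tree's `CossartPiltant2019General`. [cite: CossartPiltant2019, Thm. 1.1] -/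
theorem general (h : CossartPiltant2019Thm11Projective.{u}) : CossartPiltant2019General.{u} :=
  h.thm11.general

end CossartPiltant2019Thm11Projective

/-! ## Corollary 1.2 (with "projective") -/

/-- NAMED FACT — **Cossart–Piltant 2019, Corollary 1.2**, VERBATIM: "Let `A` be a reduced
complete Noetherian local ring of dimension three. Then `𝒳 := Spec A` has a good resolution of
singularities which is projective." Rendering: for every reduced complete
(`IsAdicComplete (maximalIdeal A) A`) Noetherian local ring `A` with `ringKrullDim A = 3` there is
a good resolution `π : 𝒳' → Spec A` (`IsGoodResolution`) with `𝒳'` projective over `A` via `π`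
(`Crystalline.IsProjectiveOverRing (Over.mk π)`). PROVED below from the complete Thm. 1.1
(`cor12_of_thm11Projective`), as in print; implies `CossartPiltant2019Cor12Good`. Users may take
`(h : CossartPiltant2019Cor12)`. [cite: CossartPiltant2019, Cor. 1.2] -/
def CossartPiltant2019Cor12 : Prop :=
  ∀ (A : Type u) [CommRing A] [IsLocalRing A] [IsNoetherianRing A]
    [IsAdicComplete (maximalIdeal A) A] [_root_.IsReduced A],
    ringKrullDim A = 3 →
      ∃ (X' : Scheme.{u}) (π : X' ⟶ Spec (.of A)), IsGoodResolution π ∧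
        IsProjectiveOverRing (Over.mk π : SchemeOver A)

/-- Cor. 1.2 with "projective" gives Cor. 1.2 without it. [cite: CossartPiltant2019, Cor. 1.2] -/
theorem CossartPiltant2019Cor12.cor12Good (h : CossartPiltant2019Cor12.{u}) :
    CossartPiltant2019Cor12Good.{u} := by
  intro A _ _ _ _ _ hdim
  obtain ⟨X', π, hπ, -⟩ := h A hdim
  exact ⟨X', π, hπ⟩

/-- **Cor. 1.2 from the complete Thm. 1.1**, as in print: a complete Noetherian local ring is
excellent (`Stacks07QW_complete`), so `Spec A` is a reduced separated Noetherian quasi-excellent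
scheme (`Stacks07QU`) of dimension `3`; Thm. 1.1 applied to the one-piece affine covering
`Spec A = Spec A` gives a good resolution `π` with `𝒳' ×_{Spec A} Spec A → Spec A` projective, and
`𝒳' ×_{Spec A} Spec A ≅ 𝒳'` over `A`. [cite: CossartPiltant2019, Cor. 1.2] -/
theorem cor12_of_thm11Projective (h : CossartPiltant2019Thm11Projective.{u})
    (h07 : Stacks07QU.{u}) (h07c : Stacks07QW_complete.{u}) : CossartPiltant2019Cor12.{u} := by
  intro A _ _ _ _ _ hdim
  have hA : IsQuasiExcellentRing A := (h07c A).isQuasiExcellentRing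
  haveI : IsNoetherianRing (CommRingCat.of A) := ‹IsNoetherianRing A›
  have hqe := Scheme.isQuasiExcellent_of_locallyOfFiniteType_of_isQuasiExcellentRing h07 hA
    (𝟙 (Spec (.of A)))
  have hdim' : topologicalKrullDim (Spec (.of A)) ≤ 3 :=
    (le_of_eq (PrimeSpectrum.topologicalKrullDim_eq_ringKrullDim (R := A))).trans (le_of_eq hdim)
  obtain ⟨X', π, hπ, hproj⟩ := h (Spec (.of A)) hqe hdim' (affineOpenCoverSelf A)
  refine ⟨X', π, hπ, isProjectiveOverRing_of_iso ?_ (hproj PUnit.unit)⟩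
  have hc : pullback.fst π (𝟙 (Spec (.of A))) ≫ π = pullback.snd π (𝟙 (Spec (.of A))) := by
    simpa using pullback.condition (f := π) (g := 𝟙 (Spec (.of A)))
  refine Over.isoMk (asIso (pullback.fst π (𝟙 (Spec (.of A))))).symm ?_
  show inv (pullback.fst π (𝟙 (Spec (.of A)))) ≫ pullback.snd π (𝟙 (Spec (.of A))) = π
  rw [IsIso.inv_comp_eq]
  exact hc.symm

/-! ## Corollary 1.3 (regular models of projective surfaces over excellent Dedekind domains) -/

/-- NAMED FACT — **Cossart–Piltant 2019, Corollary 1.3**, VERBATIM: "Let `𝒪` be an excellent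
Dedekind domain with quotient field `F` and `Σ/F` be a regular projective surface. There exists a
proper and flat `𝒪`-scheme `𝒳` with generic fiber `𝒳_F = Σ` which is everywhere regular."
Rendering: `𝒪` a Dedekind domain (`IsDedekindDomain`) which is excellent
(`Resolution.IsExcellentRing`), `F` its fraction field (`IsFractionRing 𝒪 F`), `Σ` an `F`-scheme
which is projective over `F` (`Motives.IsProjectiveOver`), integral, regular
(`Scheme.IsRegular`) and of dimension two; conclusion: a scheme `𝒳` with a proper flat morphism
`g : 𝒳 → Spec 𝒪`, `𝒳` regular, and an `F`-isomorphism `𝒳 ×_{Spec 𝒪} Spec F ≅ Σ`. For integral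
`Σ` only (see the module docstring). This is a theorem in print (derived there from Thm. 1.1).
Users take `(h : CossartPiltant2019Cor13)`. [cite: CossartPiltant2019, Cor. 1.3] -/
def CossartPiltant2019Cor13 : Prop :=
  ∀ (O : Type u) [CommRing O] [IsDedekindDomain O], IsExcellentRing O →
    ∀ (F : Type u) [Field F] [Algebra O F] [IsFractionRing O F] (S : SchemeOver F),
      IsProjectiveOver S → IsIntegral S.left → Scheme.IsRegular S.left →
      topologicalKrullDim S.left = 2 →
        ∃ (𝒳 : Scheme.{u}) (g : 𝒳 ⟶ Spec (.of O)), IsProper g ∧ Flat g ∧ Scheme.IsRegular 𝒳 ∧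
          Nonempty (Over.mk (pullback.snd g (Spec.map (CommRingCat.ofHom (algebraMap O F)))) ≅ S)

end Literature.AlgebraicGeometry.CossartPiltant200819.CP2019

end
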